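import Summits.HodgeConjecture.HodgeConjecture.Theorems.F0P3LocalClassRouting              -- ★ p826873: `localRouting_of_memXiFamily` (letter form) + its whole import cone (K3, K5, compact centre)
import HarnessLib

/-!
# Crux `H413` — THE CONSUMERS OF (SqNS) RE-THREADED TO THE NON-SPLIT FORM (SqNS♭): K3, the local routing glue of #82, and #79 (XP)

F0∕P3 «U3-mult», cell `hodgecm-mathlib`, crux item `stmt-HodgeConjecture-24833`; A-p03 (g22) on F0P3-plan (g7)'s «=» 2026-08-31T19:48:39Z (3)
(«you file the two consumer re-thread editions taking `hSq♭`»).  PROOF lane (theorems only; no `def`, no instance, no notation, no `sorry`).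

THE POINT.  The letter #90 (SqNS) `Rogawski1990.SquareIntegrableNotSphericalCofinite L` speaks of ALL cofinitely many finite places `v` of `L⁺`, but BOTH
its consumers use it only at NON-SPLIT `v`: ★ `F0P3LocalClassRouting.localRouting_of_memXiFamily` (the split branch closes by the D6 singleton) and ★
`F0P3XiPinSphericalOfSqIntNotSpherical` (#79 XP is a non-split statement).  Road (B) «local» proves the NON-SPLIT form
  (SqNS♭)  `∀ᶠ v, (∀ w ∣ v, c̄ • w = w) → ∀ μZ Haar on U(Φ₃)(L⁺_v)⧸Z, ∀ c : IrrClass, c square-integrable mod centre → c not U(Φ₃)(𝒪_v)-spherical`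
IN-HOUSE (A-p03 (g22) ★ p832624 ∕ p833008 ∕ p833380: the hyperspecial vertex of the Bruhat–Tits tree of `U(3)` carries no `L²` spherical function;
B-p08 (g23) ★ p832978 ∕ `F0P3SqIntNotSphericalOfHeckeNeighbours`: the CM transport; cofinite wrapper `F0P3SqIntNotSphericalNonsplitCofinite`).  This file
re-threads the consumers to take (SqNS♭) as a HYPOTHESIS `hSq` in that exact shape (the hypothesis-free corollaries are one application each, in the
sequel that imports the wrapper):
* §1 `eventually_not_isSupercuspidal_of_isSpherical_congr_of_nonsplit` — ★ K3 (`SupercuspidalNotSphericalCofinite` §3b) from (SqNS♭), with the guard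
  `(∀ w ∣ v, c̄ • w = w) →` added in front of its `IsCompact Z(G_v) →` (compact centre happens only at non-split `v` anyway);
* §2 **`localRouting_of_memXiFamily_of_nonsplit`** — ★ `localRouting_of_memXiFamily` from (SqNS♭): SAME conclusion (the two clauses of ★ `RoutesAt`), same
  binders otherwise; the ★ proof token for token with `hSq`'s two uses (:132, :137 of the ★ file) fed `hns`;
* (§3, #79 XP from (SqNS♭), is ★ `F0P3XiPinSphericalCofiniteHolds.xiPinSphericalCofinite_of_nonsplit_cofinite` (B-p08 (g23) p833615) — not restated here.)
HONEST LABEL: HC_CM is proved only modulo the printed citations until rung 0 closes; this file proves implications only.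
-/

set_option autoImplicit false
set_option linter.dupNamespace false

noncomputable section

open NumberField IsDedekindDomain MeasureTheory Filter
open Literature.NumberTheory.Rogawski1990 Literature.NumberTheory.GaloisRepresentations
open Literature.NumberTheory.Automorphic Literature.NumberTheory.Automorphic.UnitaryGroup
open scoped Matrix Classical ComplexOrder

namespace Summit.HodgeConjecture.HodgeConjecture.Cruxes.H413.F0P3SqNSNonsplitConsumers

open Summit.HodgeConjecture.HodgeConjecture.Cruxes.H413.F0P3InnerFormClassificationV6
open Summit.HodgeConjecture.HodgeConjecture.Cruxes.H413.F0P3ClassTokenChoice (clFinChoice admUnitConstituents clFinChoice_spec_of_exists_spherical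
  mem_admUnitConstituents_iff)

variable (L : Type) [Field L] [NumberField L] [IsCMField L] (H : Matrix (Fin 3) (Fin 3) L)

/-! ## §1 K3 from (SqNS♭) -/

/-- **(ScNS♭) FOR AN INNER FORM, FROM (SqNS♭)**: at all but finitely many NON-SPLIT `v` (compact centre), along any level-matching `e : U(H)(L⁺_v) ≃ₜ* U(Φ₃)(L⁺_v)`,
a `K_v^{H}`-spherical class is not supercuspidal (★ K3 `…eventually_not_isSupercuspidal_of_isSpherical_congr` with its input weakened to (SqNS♭); supercuspidal ⇒
square-integrable modulo the compact centre ★ `IrrClass.isSquareIntegrable_of_isSupercuspidal_of_isCompact_center`).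
[cite: Rogawski1990, §14.2 pp. 232–233; §13.1 Prop. 13.1.3 (d) p. 199; §12.2 p. 173] [cite: HarishChandra1970, Part I §3, p. 9] -/
theorem eventually_not_isSupercuspidal_of_isSpherical_congr_of_nonsplit
    (hSq : ∀ᶠ v : HeightOneSpectrum (𝓞 ↥(maximalRealSubfield L)) in cofinite,
      (∀ w : PlacesOver L v, IsCMField.complexConj L • w.1 = w.1) →
      ∀ [MeasurableSpace (Gqs L v ⧸ Subgroup.center (Gqs L v))] [BorelSpace (Gqs L v ⧸ Subgroup.center (Gqs L v))]
        (μZ : Measure (Gqs L v ⧸ Subgroup.center (Gqs L v))) [μZ.IsHaarMeasure] (c : IrrClass (Gqs L v)),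
        c.IsSquareIntegrable μZ → ¬ c.IsSpherical (cmLocalIntegralLevel L 3 (qsForm L) v)) :
    ∀ᶠ v : HeightOneSpectrum (𝓞 ↥(maximalRealSubfield L)) in cofinite,
      (∀ w : PlacesOver L v, IsCMField.complexConj L • w.1 = w.1) →
      IsCompact ((Subgroup.center (Gqs L v) : Subgroup (Gqs L v)) : Set (Gqs L v)) →
      ∀ [MeasurableSpace (Gqs L v ⧸ Subgroup.center (Gqs L v))] [BorelSpace (Gqs L v ⧸ Subgroup.center (Gqs L v))]
        (μZ : Measure (Gqs L v ⧸ Subgroup.center (Gqs L v))) [μZ.IsHaarMeasure]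
        (e : (cmDatum L 3 H).Local v ≃ₜ* Gqs L v),
        (∀ g : (cmDatum L 3 H).Local v, e g ∈ cmLocalIntegralLevel L 3 (qsForm L) v ↔ g ∈ cmLocalIntegralLevel L 3 H v) →
        ∀ c : IrrClass ((cmDatum L 3 H).Local v), c.IsSpherical (cmLocalIntegralLevel L 3 H v) → ¬ c.IsSupercuspidal := by
  filter_upwards [hSq] with v hv
  intro hns hZ _ _ μZ _ e he c hsph hc
  have hcd : c = IrrClass.comap e (IrrClass.comap e.symm c) := (IrrClass.comap_comap_symm e c).symm
  rw [hcd] at hsph hc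
  exact hv hns μZ (IrrClass.comap e.symm c)
    (IrrClass.isSquareIntegrable_of_isSupercuspidal_of_isCompact_center μZ hZ _ ((IrrClass.isSupercuspidal_comap_iff e _).1 hc))
    ((IrrClass.isSpherical_comap_iff_of_forall_mem_iff e _ he).1 hsph)

/-! ## §2 The local routing glue of #82 from (SqNS♭) -/

/-- **LOCAL ROUTING FROM THE NON-SPLIT FORM (SqNS♭)** — ★ `F0P3LocalClassRouting.localRouting_of_memXiFamily` with its hypothesis `hSq` (the letter (SqNS) at ALL
cofinitely many places) WEAKENED to the non-split-guarded form (SqNS♭) `∀ᶠ v, (∀ w ∣ v, c̄ w = w) → …` — the only places where the proof uses it (the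
Keys-label branch and the ★ K3 branch both sit under `hns`).  Road (B) proves (SqNS♭) in-house (★ `HyperspecialUnitaryRankOneNotSquareIntegrable` +
★ `F0P3SqIntNotSphericalOfHeckeNeighbours`), so this is the edition the T2 line consumes without a letter.  Proof = the ★ proof, token for token, with the
two uses of `hSq` fed `hns`. [cite: Rogawski1990, §13.1 p. 199; §12.2 (2) p. 174; §14.2 pp. 233–234; §3.5 Lemma 3.5.3 (a) p. 28; §13.3 p. 201] [cite: Macdonald1971, Ch. V] -/
theorem localRouting_of_memXiFamily_of_nonsplit (hSq : ∀ᶠ v : HeightOneSpectrum (𝓞 ↥(maximalRealSubfield L)) in cofinite,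
      (∀ w : PlacesOver L v, IsCMField.complexConj L • w.1 = w.1) →
      ∀ [MeasurableSpace (Gqs L v ⧸ Subgroup.center (Gqs L v))] [BorelSpace (Gqs L v ⧸ Subgroup.center (Gqs L v))]
        (μZ : Measure (Gqs L v ⧸ Subgroup.center (Gqs L v))) [μZ.IsHaarMeasure] (c : IrrClass (Gqs L v)),
        c.IsSquareIntegrable μZ → ¬ c.IsSpherical (cmLocalIntegralLevel L 3 (qsForm L) v))
    (hH : (H.map (cmConjRingHom L))ᵀ = H) (hHd : IsUnit H.det)
    (μ : Measure (adelicGroupData (↥(maximalRealSubfield L)) L (IsCMField.complexConj L) 3 H).automorphicQuotient)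
    [(adelicGroupData (↥(maximalRealSubfield L)) L (IsCMField.complexConj L) 3 H).IsAutomorphicMeasure μ]
    (μω : HeckeCharacter L) (hμu : μω.IsUnitary)
    [∀ v : HeightOneSpectrum (𝓞 ↥(maximalRealSubfield L)), MeasurableSpace (Gqs L v ⧸ Subgroup.center (Gqs L v))]
    [∀ v : HeightOneSpectrum (𝓞 ↥(maximalRealSubfield L)), BorelSpace (Gqs L v ⧸ Subgroup.center (Gqs L v))]
    (μZ : ∀ v : HeightOneSpectrum (𝓞 ↥(maximalRealSubfield L)), Measure (Gqs L v ⧸ Subgroup.center (Gqs L v)))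
    [∀ v : HeightOneSpectrum (𝓞 ↥(maximalRealSubfield L)), (μZ v).IsHaarMeasure]
    (keys : ∀ (ξ : OneDimAutRepH L) (v : HeightOneSpectrum (𝓞 ↥(maximalRealSubfield L))),
      (∀ w : PlacesOver L v, IsCMField.complexConj L • w.1 = w.1) →
        {p : IrrClass (Gqs L v) × IrrClass (Gqs L v) //
          KeysCaseTwoLabels L v (μω.semilocalComponent L v) (torusLocalComponent L (IsCMField.complexConj L) v ξ.η)
            (torusLocalComponent L (IsCMField.complexConj L) v ξ.ψ) p.1 p.2 ∧
          p.1.IsSquareIntegrable (μZ v) ∧ ¬ p.2.IsSquareIntegrable (μZ v)})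
    (P : DiscreteAutomorphicRep (adelicGroupData (↥(maximalRealSubfield L)) L (IsCMField.complexConj L) 3 H) μ) (ξ : OneDimAutRepH L)
    (hmem : MemXiFamily P hH hHd μω hμu ξ)
    (hsph : ∀ᶠ v : HeightOneSpectrum (𝓞 ↥(maximalRealSubfield L)) in cofinite, ∃ c ∈ admUnitConstituents P v, c.IsSpherical (cmLocalIntegralLevel L 3 H v)) :
    ∃ S₁ : Finset (HeightOneSpectrum (𝓞 ↥(maximalRealSubfield L))), ∀ v : HeightOneSpectrum (𝓞 ↥(maximalRealSubfield L)), v ∉ S₁ →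
      (∀ hs : ∃ w : PlacesOver L v, IsCMField.complexConj L • w.1 ≠ w.1,
          clFinChoice P v =
            (cmSplitPacket L H hH hHd v (splitWitness v hs) (splitWitness_spec v hs) (ξ.splitν₀ μω (splitWitness v hs).1)
              (ξ.locψ (splitWitness v hs).1) (ξ.norm_splitν₀_apply hμu (splitWitness v hs).1)
              (ξ.continuous_splitν₀ μω (splitWitness v hs).1) (ξ.norm_locψ_apply (splitWitness v hs).1)
              (ξ.continuous_locψ (splitWitness v hs).1)).πn) ∧
      (∀ hns : ∀ w : PlacesOver L v, IsCMField.complexConj L • w.1 = w.1,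
        ∀ (T : GL (Fin 3) (LocalRing L v)) (a : LocalRing L v) (ha : IsUnit a)
          (h : formCongr (conjLocal L (IsCMField.complexConj L) v) T (H.map (algebraMap L (LocalRing L v))) =
            a • (Matrix.of fun i j : Fin 3 => if i.val + j.val + 1 = 3 then (1 : L) else 0).map (algebraMap L (LocalRing L v))),
          (∀ g : (cmDatum L 3 H).Local v, (cmDatumLocalCongr L v T ha h).symm g ∈ cmLocalIntegralLevel L 3 (qsForm L) v ↔
            g ∈ cmLocalIntegralLevel L 3 H v) →
          clFinChoice P v = IrrClass.comap (cmDatumLocalCongr L v T ha h).symm (keys ξ v hns).1.2) := by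
  obtain ⟨Pv, hfam, hloc⟩ := hmem
  -- ★ K3 (modulo SqNS) and (K4) = SqNS hold cofinitely; so does the K2 supply
  have h3' := eventually_not_isSupercuspidal_of_isSpherical_congr_of_nonsplit L H hSq
  have hfin := Filter.eventually_cofinite.1 (hsph.and (h3'.and hSq))
  refine ⟨hfin.toFinset, fun v hv => ?_⟩
  have hv' : (∃ c ∈ admUnitConstituents P v, c.IsSpherical (cmLocalIntegralLevel L 3 H v)) ∧
      ((∀ w : PlacesOver L v, IsCMField.complexConj L • w.1 = w.1) →
       IsCompact ((Subgroup.center (Gqs L v) : Subgroup (Gqs L v)) : Set (Gqs L v)) →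
        ∀ [MeasurableSpace (Gqs L v ⧸ Subgroup.center (Gqs L v))] [BorelSpace (Gqs L v ⧸ Subgroup.center (Gqs L v))]
          (μZ' : Measure (Gqs L v ⧸ Subgroup.center (Gqs L v))) [μZ'.IsHaarMeasure]
          (e : (cmDatum L 3 H).Local v ≃ₜ* Gqs L v),
          (∀ g : (cmDatum L 3 H).Local v, e g ∈ cmLocalIntegralLevel L 3 (qsForm L) v ↔ g ∈ cmLocalIntegralLevel L 3 H v) →
          ∀ c : IrrClass ((cmDatum L 3 H).Local v), c.IsSpherical (cmLocalIntegralLevel L 3 H v) → ¬ c.IsSupercuspidal) ∧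
      ((∀ w : PlacesOver L v, IsCMField.complexConj L • w.1 = w.1) →
       ∀ [MeasurableSpace (Gqs L v ⧸ Subgroup.center (Gqs L v))] [BorelSpace (Gqs L v ⧸ Subgroup.center (Gqs L v))]
        (μZ' : Measure (Gqs L v ⧸ Subgroup.center (Gqs L v))) [μZ'.IsHaarMeasure] (c : IrrClass (Gqs L v)),
        c.IsSquareIntegrable μZ' → ¬ c.IsSpherical (cmLocalIntegralLevel L 3 (qsForm L) v)) := by
    by_contra hc
    exact hv (hfin.mem_toFinset.2 hc)
  obtain ⟨hex, h3, h4⟩ := hv'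
  -- the chosen class is a SPHERICAL constituent (branch 1), hence a member of `Pv v`
  have hspec := clFinChoice_spec_of_exists_spherical P v hex
  have hmemv : clFinChoice P v ∈ (Pv v).members := hloc v (clFinChoice P v) ((mem_admUnitConstituents_iff P v _).1 hspec.1).1
  refine ⟨fun hs => ?_, fun hns T' a' ha' h' hlev => ?_⟩
  · -- SPLIT `v`: `Pv v` is the singleton split packet at the fixed witness
    rw [hfam.1 v hs, LocalAPacket.mem_members_iff] at hmemv
    rcases hmemv with h | h
    · exact h
    · exact absurd h.symm (Option.some_ne_none _)
  · -- NON-SPLIT `v`: `Pv v = ⟨x ∘ e₀⁻¹, s⟩`, `x ∈ JH(i_G(χ_ξ))`, `s` supercuspidal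
    obtain ⟨T₀, a₀, ha₀, h₀, x, s, hPv, hx, hs'⟩ := hfam.2 v hns
    rw [hPv, LocalAPacket.mem_members_iff] at hmemv
    rcases hmemv with hcl | hcl
    · -- congruence independence (★ K5): replace `e₀ = cmDatumLocalCongr … T₀ …` by the GIVEN `e = cmDatumLocalCongr … T' …`
      obtain ⟨u, hu⟩ := UnitaryGroup.exists_cmDatumLocalCongr_eq_apply_conj L (N := 3) ⟨1, rfl⟩ hH v T₀ T' ha₀ ha' h₀ h'
      have hind : IrrClass.comap (cmDatumLocalCongr L v T₀ ha₀ h₀).symm x = IrrClass.comap (cmDatumLocalCongr L v T' ha' h').symm x :=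
        IrrClass.comap_symm_eq_comap_symm_of_forall_eq_conj (cmDatumLocalCongr L v T₀ ha₀ h₀) (cmDatumLocalCongr L v T' ha' h')
          (cmDatumLocalCongr L v T₀ ha₀ h₀ u) (fun g => by rw [hu g, map_mul, map_mul, map_inv]) x
      change clFinChoice P v = IrrClass.comap (cmDatumLocalCongr L v T₀ ha₀ h₀).symm x at hcl
      rw [hind] at hcl
      -- `x` is one of the two Keys labels
      rcases ((keys ξ v hns).2.1.2 x).1 hx with hxn | hxs
      · rw [hcl, hxn]
      · -- `x = π²` (square-integrable): its transport along the LEVEL-MATCHING `e` would be `K_v`-spherical — contradicts (SqNS)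
        exfalso
        have hsph' : (IrrClass.comap (cmDatumLocalCongr L v T' ha' h').symm (keys ξ v hns).1.1).IsSpherical (cmLocalIntegralLevel L 3 H v) := by
          rw [← hxs, ← hcl]
          exact hspec.2
        exact h4 hns (μZ v) _ (keys ξ v hns).2.2.1 ((IrrClass.isSpherical_comap_iff_of_forall_mem_iff _ _ hlev).1 hsph')
    · -- `clFinChoice P v = s` supercuspidal — contradicts ★ K3 (it is `K_v`-spherical; compact centre at the non-split `v`, level-matching `e`)
      have hZ : IsCompact ((Subgroup.center (Gqs L v) : Subgroup (Gqs L v)) : Set (Gqs L v)) :=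
        (F0P3bLocalNonsplitCompactCenter.local_nonsplit_compactOpen_center_of_center_le L 3 (qsForm L) (isUnit_antidiagOne_det L 3) v hns
          (forall_mem_center_cmLocal_eq_scalar L (qsForm L) (antidiagOne_isHermitian L 3) (isUnit_antidiagOne_det L 3) v hns)).2
      exact (h3 hns hZ (μZ v) (cmDatumLocalCongr L v T' ha' h').symm hlev _ hspec.2 (hs' _ hcl)).elim


/-! ## §3 #79 (XP) from (SqNS♭): ★ ELSEWHERE — `F0P3XiPinSphericalCofiniteHolds.xiPinSphericalCofinite_of_nonsplit_cofinite` (B-p08 (g23) p833615), not restated here. -/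

end Summit.HodgeConjecture.HodgeConjecture.Cruxes.H413.F0P3SqNSNonsplitConsumers

end
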